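import Summits.ABC.IUTFork.Cor312UnionCoverLattice
import HarnessLib

/-!
# [IUTchIII] Cor. 3.12 — the UNION-COVER bed P♮ᵤ (honest plane model), II: the co-rank-one Θ-lattice, the table volume, the frame, the setting

Record-only file (D-0012; MODEL DATA + folklore lemmas, no `Prop` fact, nothing asserted about print) of the abc-iut cell (IUT REPAIR branch B,
sub-cell B3 Joshi, seat abc-iut-rp-j1 gen 4; rung LADDER-ABC:A2.RP), sequel of `Cor312UnionCoverShells` / `Cor312UnionCoverLattice` (plane shells `ℚ²`
over `toyIndex` with Ism the stabiliser of the log-shell `ℤ²`; coordinates; the closure lemma «⟨(Ind1)∪(Ind2)⟩ acts by lattice automorphisms»; the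
`SL₂(ℤ)` movers). TAKES NO SIDE on [IUTchIII] Cor. 3.12 and no side between Mochizuki, Scholze–Stix, Joshi or Dupuy–Hilado.
THE BED (this file = the model data; proofs in part III `Cor312UnionCoverThm311`, the B3 cells in `Repair/CandJoshi3Union`), for a prime `p`:
* q-REGION = the ball `p·Λ_j` (average-depth log-volume `−1` at EVERY label — label-INDEPENDENT); Θ-REGION = **the CO-RANK-ONE Θ-LATTICE INSIDE IT**
  `thetaLat p j = {x ∈ p·Λ_j | p^{e_j} ∣ x_top}`, `e_j = 1 + (j²−1)·2^{j+1}` (the all-`true` coordinate deepened): index `p^{(j²−1)·2^{j+1}}` in `p·Λ_j`,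
  average-depth log-volume `−j² = j²·(−1)` — the HONEST `j²`-SCALING of the ∀-countermodel (abc-iut-w5-d155 p419757) — and `Θ ⊆ q` (RF-J2) as for the
  printed `q^{j²}𝒪 ⊆ q𝒪`; at the labels `0`, `1` the Θ-lattice IS the q-ball;
* ADMISSIBLE regions `uAdm` = the balls `p^kΛ_j` and the ⟨(Ind1)∪(Ind2)⟩-translates of `thetaLat p j` (`j ≠ 0`); the LOG-VOLUME `uVol` = minus the
  average depth on them: `−k` (`uVol_ball`), `−j²` (`uVol_thetaImage`; consistent: a Θ-image is a ball only at the label `1`, where both read `−1`,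
  `thetaImage_eq_ball`), MONOTONE (`uVol_mono`) and INVARIANT with its domain under every `Φ ∈ ⟨(Ind1)∪(Ind2)⟩` (`uAdm_image_iff`, `uVol_image`) —
  Step (x) holds NON-trivially for an INFINITE mover group;
* the SCALAR hull frame `uFrame` (hull-sets the balls `p^kΛ_j`, `k ≤ K = 32 = 2²·2³`; relatively compact = inside `Λ_j`; hull = `p^{depth U}Λ_j`);
* data `uData` (integral structure `Λ_j`, Θ-datum the PRODUCT set `thetaSet` of the Θ-lattices over `𝔽_l^⋇`), column `uColumn` (identity Kummer
  transport), full situation `uFull` (abc-iut-w5-d247's `naiveLink`), setting `uSetting` (column `0`, abc-iut-w4-d101's honest object side `pinSig` /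
  `ExpMonoid`, glue `thetaGlue` / `qGlue` READING THE EXPONENT), the region operator `ptRegion` («the set of `j`-components of the datum»), the q-datum.
HONEST SCOPE: interface-level toy (`l⋇ = 2`, one place). VOLUMES are honest (exact `j²`, label-independent q, Step (x) for an infinite isometry group,
fine scalar frame); the Θ-region's SHAPE (all depth on one coordinate) and the product datum `thetaSet` are NOT derived from [IUTchI] Def. 3.1 data —
they model the MECHANISM «a Θ-region not stable under a basis-mixing isometric (Ind2) has a union of possible images strictly larger than any one of
them» (Dupuy–Hilado §6.2 orbit excursion, covering form; Joshi's `Θ̃` = Aut-stable closure, arXiv:2111.04890v2 §9), at honest volumes. No judgement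
on print; no `Prop` fact; standard axioms. [claim: Mochizuki2012, status: disputed] for every IUT noun. [cite: DupuyHilado2020, §3.3, §6.2]
-/

noncomputable section

open Set

namespace Summit.ABC.IUTFork.Cor312Vol

namespace UnionWitness

open Thm311 Cor312 Cor312.Checks Cor312.IdentifiedNonVacuity NaiveWitness PinnedWitness Literature.IUT.LogThetaLattice

variable (p : ℕ)

/-! ## 6. The regions: the q-ball `p·Λ_j` and the co-rank-one Θ-lattice inside it -/
/-- A prime is at least `2`. [folklore] -/
theorem two_le_of_prime [hp : Fact p.Prime] : 2 ≤ p := hp.out.two_le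
/-- A prime is nonzero. [folklore] -/
theorem ne_zero_of_prime [hp : Fact p.Prime] : p ≠ 0 := hp.out.ne_zero

/-- The TOP coordinate index: all components `true`. [folklore] -/
def top (j : toyIndex.Label) : toyIndex.Caps j → Bool := fun _ => true
/-- The BOTTOM coordinate index: all components `false`. [folklore] -/
def bot (j : toyIndex.Label) : toyIndex.Caps j → Bool := fun _ => false
/-- `bot ≠ top` (a capsule has at least one index). [folklore] -/
theorem bot_ne_top (j : toyIndex.Label) : bot j ≠ top j := fun h => by have := congrFun h (Fin.last _); simp [bot, top] at this

/-- The TOP DEPTH `e_j = 1 + (j² − 1)·2^{j+1}` of the Θ-lattice: the sub-lattice of `p·Λ_j` (rank `2^{j+1}`, average depth `1`) whose top coordinate has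
depth `e_j` has index `p^{(j²−1)·2^{j+1}}` in `p·Λ_j`, hence AVERAGE depth `1 + (j² − 1) = j²` (`e_0 = e_1 = 1`, `e_2 = 25`). [folklore] -/
def eTop (j : toyIndex.Label) : ℕ := 1 + ((j : ℕ) ^ 2 - 1) * 2 ^ ((j : ℕ) + 1)

/-- `1 ≤ e_j`. [folklore] -/
theorem one_le_eTop (j : toyIndex.Label) : 1 ≤ eTop j := Nat.le_add_right 1 _
/-- `j² ≤ e_j`. [folklore] -/
theorem sq_le_eTop (j : toyIndex.Label) : (j : ℕ) ^ 2 ≤ eTop j := by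
  rcases Nat.eq_zero_or_pos ((j : ℕ) ^ 2) with h | h
  · rw [h]; exact Nat.zero_le _
  · calc (j : ℕ) ^ 2 = 1 + ((j : ℕ) ^ 2 - 1) := (Nat.add_sub_cancel' h).symm
      _ ≤ eTop j := Nat.add_le_add_left (Nat.le_mul_of_pos_right _ (Nat.pos_of_ne_zero (pow_ne_zero _ two_ne_zero))) 1

/-- `e_j ≤ 1` forces `j² = 1` for a nonzero label (only at the label `1` is the Θ-lattice a ball). [folklore] -/
theorem sq_eq_one_of_eTop_le_one {j : toyIndex.Label} (hj : j ≠ 0) (h : eTop j ≤ 1) : (j : ℕ) ^ 2 = 1 := by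
  unfold eTop at h
  have h1 : ((j : ℕ) ^ 2 - 1) * 2 ^ ((j : ℕ) + 1) = 0 := by omega
  have h2 : (j : ℕ) ^ 2 - 1 = 0 := (Nat.mul_eq_zero.1 h1).resolve_right (pow_ne_zero _ two_ne_zero)
  have h3 : (j : ℕ) ≠ 0 := fun h0 => hj (Fin.ext h0)
  have h4 : 0 < (j : ℕ) ^ 2 := pow_pos (Nat.pos_of_ne_zero h3) 2
  omega

/-- The CO-RANK-ONE LATTICE of ball-depth `b` and top-depth `e`: tensors in `p^bΛ_j` whose TOP coordinate has depth `≥ e`. [folklore] -/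
def coLatt (j : toyIndex.Label) (vQ : toyIndex.VQ) (b e : ℕ) : Set (plane.Packet j vQ) := {x | x ∈ ball p j vQ b ∧ Deep p e (coord j vQ (top j) x)}

/-- **The Θ-LATTICE `thetaLat p j`** = `coLatt 1 e_j`: the Θ-pilot region of P♮ᵤ at label `j` — INSIDE the q-ball `p·Λ_j`, of index `p^{(j²−1)·2^{j+1}}`
there (average depth `j²`); at the labels `0`, `1` it IS the q-ball. [claim: Mochizuki2012, status: disputed] -/
def thetaLat (j : toyIndex.Label) (vQ : toyIndex.VQ) : Set (plane.Packet j vQ) := coLatt p j vQ 1 (eTop j)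

/-- A top-depth below the ball-depth is no condition: `coLatt b e = p^bΛ_j` for `e ≤ b`. [folklore] -/
theorem coLatt_of_le (j : toyIndex.Label) (vQ : toyIndex.VQ) {b e : ℕ} (h : e ≤ b) : coLatt p j vQ b e = ball p j vQ b :=
  Set.ext fun _ => ⟨fun hx => hx.1, fun hx => ⟨hx, (hx _).mono h⟩⟩

/-- At the zero label the Θ-lattice is the q-ball `p·Λ_0` (`e_0 = 1`). [folklore] -/
theorem thetaLat_zero (vQ : toyIndex.VQ) : thetaLat p 0 vQ = ball p 0 vQ 1 := coLatt_of_le p 0 vQ le_rfl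
/-- The Θ-lattice lies in the q-ball `p·Λ_j` (RF-J2 of `Repair/CandJoshi3`: «Θ-images inside the q-region» HOLDS here) … [folklore] -/
theorem thetaLat_subset_ball (j : toyIndex.Label) (vQ : toyIndex.VQ) : thetaLat p j vQ ⊆ ball p j vQ 1 := fun _ h => h.1
/-- … and in `Λ_j`. [folklore] -/
theorem thetaLat_subset_latt (j : toyIndex.Label) (vQ : toyIndex.VQ) : thetaLat p j vQ ⊆ latt j vQ := (thetaLat_subset_ball p j vQ).trans (ball_subset_latt p j vQ 1)

/-- `0` lies in the Θ-lattice (Θ-regions are nonempty). [folklore] -/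
theorem zero_mem_thetaLat (j : toyIndex.Label) (vQ : toyIndex.VQ) : (0 : plane.Packet j vQ) ∈ thetaLat p j vQ :=
  ⟨zero_mem_ball p j vQ 1, by rw [map_zero]; exact Deep.zero p _⟩

/-- `p·e_bot` lies in the Θ-lattice (its top coordinate is `0`) … [folklore] -/
theorem smul_ePt_bot_mem_thetaLat (j : toyIndex.Label) (vQ : toyIndex.VQ) : ((p : ℚ) ^ 1) • ePt j vQ (bot j) ∈ thetaLat p j vQ :=
  ⟨smul_ePt_mem_ball p j vQ 1 _, by rw [map_smul, smul_eq_mul, coord_ePt, if_neg (bot_ne_top j), mul_zero]; exact Deep.zero p _⟩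

/-- … so the Θ-lattice lies in the ball `p^kΛ_j` iff `k ≤ 1` (`p` prime). [folklore] -/
theorem thetaLat_subset_ball_iff [Fact p.Prime] (j : toyIndex.Label) (vQ : toyIndex.VQ) (k : ℕ) : thetaLat p j vQ ⊆ ball p j vQ k ↔ k ≤ 1 :=
  ⟨fun h => (smul_ePt_mem_ball_iff (two_le_of_prime p) j vQ 1 k _).1 (h (smul_ePt_bot_mem_thetaLat p j vQ)),
    fun h => (thetaLat_subset_ball p j vQ).trans (ball_antitone p j vQ h)⟩

/-- `p^k·e_top` lies in the Θ-lattice iff `e_j ≤ k` (`p` prime) … [folklore] -/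
theorem smul_ePt_top_mem_thetaLat_iff [Fact p.Prime] (j : toyIndex.Label) (vQ : toyIndex.VQ) (k : ℕ) :
    ((p : ℚ) ^ k) • ePt j vQ (top j) ∈ thetaLat p j vQ ↔ eTop j ≤ k := by
  refine ⟨fun h => ?_, fun h => ⟨ball_antitone p j vQ ((one_le_eTop j).trans h) (smul_ePt_mem_ball p j vQ k (top j)), ?_⟩⟩
  · have h2 := h.2
    rw [map_smul, smul_eq_mul, coord_ePt, if_pos rfl, mul_one] at h2
    exact (deep_pow_iff (two_le_of_prime p)).1 h2
  · rw [map_smul, smul_eq_mul, coord_ePt, if_pos rfl, mul_one]; exact (deep_pow_self p k).mono h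

/-- … so the ball `p^kΛ_j` lies in the Θ-lattice iff `e_j ≤ k` (`p` prime). [folklore] -/
theorem ball_subset_thetaLat_iff [Fact p.Prime] (j : toyIndex.Label) (vQ : toyIndex.VQ) (k : ℕ) : ball p j vQ k ⊆ thetaLat p j vQ ↔ eTop j ≤ k :=
  ⟨fun h => (smul_ePt_top_mem_thetaLat_iff p j vQ k).1 (h (smul_ePt_mem_ball p j vQ k _)),
    fun h _ hx => ⟨ball_antitone p j vQ ((one_le_eTop j).trans h) hx, (hx _).mono h⟩⟩

/-! ## 7. The admissible regions and the average-depth log-volume (a table), monotone and (Ind1)/(Ind2)-invariant -/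

/-- A Θ-IMAGE at a label `j ≠ 0`: an ⟨(Ind1)∪(Ind2)⟩-translate of the Θ-lattice (these are the possible images of the Θ-pilot in P♮ᵤ, part III).
[folklore] -/
def IsThetaImage (j : toyIndex.Label) (vQ : toyIndex.VQ) (A : Set (plane.Packet j vQ)) : Prop :=
  j ≠ 0 ∧ ∃ Φ ∈ Subgroup.closure (plane.Ind1Family ∪ plane.Ind2Family), A = Φ j vQ '' thetaLat p j vQ

/-- **The ADMISSIBLE regions `𝕄` of P♮ᵤ**: the balls `p^kΛ_j` and the Θ-images. [claim: Mochizuki2012, status: disputed] -/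
def uAdm (j : toyIndex.Label) (vQ : toyIndex.VQ) (A : Set (plane.Packet j vQ)) : Prop := (∃ k : ℕ, A = ball p j vQ k) ∨ IsThetaImage p j vQ A

open scoped Classical in
/-- **The LOG-VOLUME of P♮ᵤ** = minus the AVERAGE depth (Dupuy–Hilado's expectation over the `2^{j+1}` summands): `−k` on the ball `p^kΛ_j`, `−j²` on a
Θ-image (index `p^{(j²−1)·2^{j+1}}` in `p·Λ_j`), `0` elsewhere. [claim: Mochizuki2012, status: disputed] [cite: DupuyHilado2020, §3.3] -/
def uVol (j : toyIndex.Label) (vQ : toyIndex.VQ) (A : Set (plane.Packet j vQ)) : ℝ :=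
  if h : ∃ k : ℕ, A = ball p j vQ k then -((Classical.choose h : ℕ) : ℝ) else if IsThetaImage p j vQ A then -(((j : ℕ) : ℝ) ^ 2) else 0

variable {p}

/-- A Θ-image inside a ball forces the ball to be `Λ_j` or `p·Λ_j`: `Φ·thetaLat ⊆ p^kΛ_j ⟹ k ≤ 1`. [folklore] -/
theorem le_one_of_thetaImage_subset [Fact p.Prime] {j : toyIndex.Label} {vQ : toyIndex.VQ} {Φ : plane.PacketAut}
    (hΦ : Φ ∈ Subgroup.closure (plane.Ind1Family ∪ plane.Ind2Family)) {k : ℕ} (h : Φ j vQ '' thetaLat p j vQ ⊆ ball p j vQ k) : k ≤ 1 := by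
  rw [← (integral_of_mem_closure hΦ).image_ball (ne_zero_of_prime p) j vQ k, Set.image_subset_image_iff (LinearEquiv.injective _)] at h
  exact (thetaLat_subset_ball_iff p j vQ k).1 h

/-- A ball inside a Θ-image is deep: `p^kΛ_j ⊆ Φ·thetaLat ⟹ e_j ≤ k`. [folklore] -/
theorem eTop_le_of_ball_subset [Fact p.Prime] {j : toyIndex.Label} {vQ : toyIndex.VQ} {Φ : plane.PacketAut}
    (hΦ : Φ ∈ Subgroup.closure (plane.Ind1Family ∪ plane.Ind2Family)) {k : ℕ} (h : ball p j vQ k ⊆ Φ j vQ '' thetaLat p j vQ) : eTop j ≤ k := by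
  rw [← (integral_of_mem_closure hΦ).image_ball (ne_zero_of_prime p) j vQ k, Set.image_subset_image_iff (LinearEquiv.injective _)] at h
  exact (ball_subset_thetaLat_iff p j vQ k).1 h

/-- **A Θ-image that is a ball is the q-ball at the label `1`** (`p` prime; `j ≠ 0`): `Φ·thetaLat = p^kΛ_j ⟹ k = 1 ∧ j² = 1`. [folklore] -/
theorem thetaImage_eq_ball [Fact p.Prime] {j : toyIndex.Label} {vQ : toyIndex.VQ} {Φ : plane.PacketAut}
    (hΦ : Φ ∈ Subgroup.closure (plane.Ind1Family ∪ plane.Ind2Family)) (hj : j ≠ 0) {k : ℕ} (h : Φ j vQ '' thetaLat p j vQ = ball p j vQ k) :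
    k = 1 ∧ (j : ℕ) ^ 2 = 1 := by
  have h1 : k ≤ 1 := le_one_of_thetaImage_subset hΦ h.subset
  have h2 : eTop j ≤ k := eTop_le_of_ball_subset hΦ h.symm.subset
  exact ⟨le_antisymm h1 ((one_le_eTop j).trans h2), sq_eq_one_of_eTop_le_one hj (h2.trans h1)⟩

/-- **The log-volume of the ball `p^kΛ_j` is `−k`.** [folklore] -/
theorem uVol_ball [Fact p.Prime] (j : toyIndex.Label) (vQ : toyIndex.VQ) (k : ℕ) : uVol p j vQ (ball p j vQ k) = -(k : ℝ) := by
  have h : ∃ k' : ℕ, ball p j vQ k = ball p j vQ k' := ⟨k, rfl⟩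
  unfold uVol; rw [dif_pos h, ← (ball_injective (two_le_of_prime p) j vQ (Classical.choose_spec h))]

/-- **The log-volume of a Θ-image is `−j²`** (`j ≠ 0`; at the label `1` the image is the q-ball itself, of volume `−1 = −1²`). [folklore] -/
theorem uVol_thetaImage [Fact p.Prime] {j : toyIndex.Label} {vQ : toyIndex.VQ} {Φ : plane.PacketAut}
    (hΦ : Φ ∈ Subgroup.closure (plane.Ind1Family ∪ plane.Ind2Family)) (hj : j ≠ 0) :
    uVol p j vQ (Φ j vQ '' thetaLat p j vQ) = -(((j : ℕ) : ℝ) ^ 2) := by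
  by_cases h : ∃ k : ℕ, Φ j vQ '' thetaLat p j vQ = ball p j vQ k
  · obtain ⟨k, hk⟩ := h
    obtain ⟨rfl, hj1⟩ := thetaImage_eq_ball hΦ hj hk
    rw [hk, uVol_ball, Nat.cast_one, show (((j : ℕ) : ℝ) ^ 2) = 1 by exact_mod_cast hj1]
  · unfold uVol; rw [dif_neg h, if_pos ⟨hj, Φ, hΦ, rfl⟩]

/-- The Θ-lattice itself has log-volume `−j²` (the identity translate; `j ≠ 0`). [folklore] -/
theorem uVol_thetaLat [Fact p.Prime] {j : toyIndex.Label} (hj : j ≠ 0) (vQ : toyIndex.VQ) : uVol p j vQ (thetaLat p j vQ) = -(((j : ℕ) : ℝ) ^ 2) := by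
  have h := uVol_thetaImage (p := p) (vQ := vQ) (Subgroup.one_mem _) hj
  rwa [show (1 : plane.PacketAut) j vQ '' thetaLat p j vQ = thetaLat p j vQ from Set.image_id _] at h

/-- **The log-volume is MONOTONE on admissible regions.** [folklore] -/
theorem uVol_mono [Fact p.Prime] {j : toyIndex.Label} {vQ : toyIndex.VQ} {A B : Set (plane.Packet j vQ)} (hA : uAdm p j vQ A) (hB : uAdm p j vQ B)
    (hAB : A ⊆ B) : uVol p j vQ A ≤ uVol p j vQ B := by
  rcases hA with ⟨k, rfl⟩ | ⟨hj, Φ, hΦ, rfl⟩ <;> rcases hB with ⟨k', rfl⟩ | ⟨hj', Ψ, hΨ, rfl⟩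
  · rw [uVol_ball, uVol_ball, neg_le_neg_iff, Nat.cast_le]
    exact (ball_subset_ball_iff (two_le_of_prime p) j vQ k k').1 hAB
  · rw [uVol_ball, uVol_thetaImage hΨ hj', neg_le_neg_iff]
    exact_mod_cast (sq_le_eTop j).trans (eTop_le_of_ball_subset hΨ hAB)
  · rw [uVol_ball, uVol_thetaImage hΦ hj, neg_le_neg_iff]
    have h3 : (k' : ℝ) ≤ 1 := by exact_mod_cast le_one_of_thetaImage_subset hΦ hAB
    have h4 : (1 : ℝ) ≤ ((j : ℕ) : ℝ) := by exact_mod_cast Nat.pos_of_ne_zero fun h0 => hj (Fin.ext h0)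
    nlinarith
  · rw [uVol_thetaImage hΦ hj, uVol_thetaImage hΨ hj']

/-- Admissibility is TRANSPORTED by ⟨(Ind1)∪(Ind2)⟩ (Step (x), admissibility clause). [folklore] -/
theorem uAdm_image [Fact p.Prime] {j : toyIndex.Label} {vQ : toyIndex.VQ} {Φ : plane.PacketAut}
    (hΦ : Φ ∈ Subgroup.closure (plane.Ind1Family ∪ plane.Ind2Family)) {A : Set (plane.Packet j vQ)} (hA : uAdm p j vQ A) :
    uAdm p j vQ (Φ j vQ '' A) := by
  rcases hA with ⟨k, rfl⟩ | ⟨hj, Ψ, hΨ, rfl⟩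
  · exact Or.inl ⟨k, (integral_of_mem_closure hΦ).image_ball (ne_zero_of_prime p) j vQ k⟩
  · refine Or.inr ⟨hj, Φ * Ψ, Subgroup.mul_mem _ hΦ hΨ, ?_⟩
    rw [Set.image_image]; rfl

/-- … in both directions. [folklore] -/
theorem uAdm_image_iff [Fact p.Prime] {j : toyIndex.Label} {vQ : toyIndex.VQ} {Φ : plane.PacketAut}
    (hΦ : Φ ∈ Subgroup.closure (plane.Ind1Family ∪ plane.Ind2Family)) (A : Set (plane.Packet j vQ)) :
    uAdm p j vQ A ↔ uAdm p j vQ (Φ j vQ '' A) := by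
  refine ⟨uAdm_image hΦ, fun h => ?_⟩
  have h2 := uAdm_image (Subgroup.inv_mem _ hΦ) h
  rwa [Set.image_image, show (fun x => Φ⁻¹ j vQ (Φ j vQ x)) = id from funext fun x => (Φ j vQ).symm_apply_apply x, Set.image_id] at h2

/-- **The log-volume is INVARIANT under ⟨(Ind1)∪(Ind2)⟩ on admissible regions** (Step (x), volume clause; NON-trivially: Θ-images MOVE). [folklore] -/
theorem uVol_image [Fact p.Prime] {j : toyIndex.Label} {vQ : toyIndex.VQ} {Φ : plane.PacketAut}
    (hΦ : Φ ∈ Subgroup.closure (plane.Ind1Family ∪ plane.Ind2Family)) {A : Set (plane.Packet j vQ)} (hA : uAdm p j vQ A) :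
    uVol p j vQ (Φ j vQ '' A) = uVol p j vQ A := by
  rcases hA with ⟨k, rfl⟩ | ⟨hj, Ψ, hΨ, rfl⟩
  · rw [(integral_of_mem_closure hΦ).image_ball (ne_zero_of_prime p) j vQ k]
  · rw [Set.image_image, show (fun x => Φ j vQ (Ψ j vQ x)) = fun x => (Φ * Ψ) j vQ x from rfl, uVol_thetaImage (Subgroup.mul_mem _ hΦ hΨ) hj,
      uVol_thetaImage hΨ hj]

variable (p)

/-! ## 8. The scalar hull frame (balls down to depth `K`) -/
/-- The DEPTH CAP `K = 32 = d_2`: hull-sets are the balls `p^kΛ_j`, `k ≤ K`. [folklore] -/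
def K : ℕ := 32

/-- The HULL-SETS `λ·𝒪` of P♮ᵤ: the balls `p^kΛ_j`, `k ≤ K`. [claim: Mochizuki2012, status: disputed] -/
def uHul (j : toyIndex.Label) (vQ : toyIndex.VQ) : Set (Set (plane.Packet j vQ)) := {H | ∃ k ≤ K, H = ball p j vQ k}

/-- A ball of depth `≤ K` is a hull-set. [folklore] -/
theorem ball_mem_uHul (j : toyIndex.Label) (vQ : toyIndex.VQ) {k : ℕ} (hk : k ≤ K) : ball p j vQ k ∈ uHul p j vQ := ⟨k, hk, rfl⟩
open scoped Classical in
/-- The DEPTH of a region: the largest `k ≤ K` with `U ⊆ p^kΛ_j`. [folklore] -/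
def depth (j : toyIndex.Label) (vQ : toyIndex.VQ) (U : Set (plane.Packet j vQ)) : ℕ := Nat.findGreatest (fun k => U ⊆ ball p j vQ k) K

/-- The depth is at most `K`. [folklore] -/
theorem depth_le_K (j : toyIndex.Label) (vQ : toyIndex.VQ) (U : Set (plane.Packet j vQ)) : depth p j vQ U ≤ K := by
  classical exact Nat.findGreatest_le K

/-- A bounded region lies in the ball of its depth. [folklore] -/
theorem subset_ball_depth (j : toyIndex.Label) (vQ : toyIndex.VQ) {U : Set (plane.Packet j vQ)} (hU : U ⊆ latt j vQ) :
    U ⊆ ball p j vQ (depth p j vQ U) := by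
  classical
  have h0 : U ⊆ ball p j vQ 0 := by rw [ball_zero]; exact hU
  exact Nat.findGreatest_spec (P := fun k => U ⊆ ball p j vQ k) (Nat.zero_le K) h0

/-- A ball of depth `≤ K` containing `U` bounds the depth from below. [folklore] -/
theorem le_depth (j : toyIndex.Label) (vQ : toyIndex.VQ) {U : Set (plane.Packet j vQ)} {k : ℕ} (h : U ⊆ ball p j vQ k) (hk : k ≤ K) :
    k ≤ depth p j vQ U := by
  classical exact Nat.le_findGreatest hk h

/-- **The SCALAR HULL FRAME of P♮ᵤ**: hull-sets the balls `p^kΛ_j` (`k ≤ K`), relatively compact = inside `Λ_j`, every bounded region admits its hull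
`p^{depth}Λ_j` ([IUTchIII] Rmk. 3.9.5 (i) «the smallest subset of the form `λ·𝒪` that contains `U`»). [folklore] -/
def uFrame (j : toyIndex.Label) (vQ : toyIndex.VQ) : HullFrame (plane.Packet j vQ) where
  Hul := uHul p j vQ
  IsBounded := fun U => U ⊆ latt j vQ
  HasHull := fun _ => True
  hul_bounded := fun _ hH => by obtain ⟨k, -, rfl⟩ := hH; exact ball_subset_latt p j vQ k
  bounded_mono := fun _ _ h h' => h.trans h'
  exists_hul := fun U hU => ⟨ball p j vQ 0, ball_mem_uHul p j vQ (Nat.zero_le _), by rw [ball_zero]; exact hU⟩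
  hull_mem := fun U hU _ => by
    rw [sInter_eq_of_least (S := {H | H ∈ uHul p j vQ ∧ U ⊆ H}) (H₀ := ball p j vQ (depth p j vQ U))
      ⟨ball_mem_uHul p j vQ (depth_le_K p j vQ U), subset_ball_depth p j vQ hU⟩
      fun H hH => by obtain ⟨⟨k, hk, rfl⟩, hUH⟩ := hH; exact ball_antitone p j vQ (le_depth p j vQ hUH hk)]
    exact ball_mem_uHul p j vQ (depth_le_K p j vQ U)

/-- In the scalar frame the holomorphic hull of a bounded region is the ball of its depth. [folklore] -/
theorem uFrame_hull (j : toyIndex.Label) (vQ : toyIndex.VQ) {U : Set (plane.Packet j vQ)} (hU : U ⊆ latt j vQ) :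
    (uFrame p j vQ).hull U = ball p j vQ (depth p j vQ U) := by
  unfold HullFrame.hull
  rw [if_pos (show (uFrame p j vQ).IsBounded U from hU)]
  exact sInter_eq_of_least (S := {H | H ∈ uHul p j vQ ∧ U ⊆ H}) ⟨ball_mem_uHul p j vQ (depth_le_K p j vQ U), subset_ball_depth p j vQ hU⟩
    fun H hH => by obtain ⟨⟨k, hk, rfl⟩, hUH⟩ := hH; exact ball_antitone p j vQ (le_depth p j vQ hUH hk)

/-- The hull of a ball of depth `k ≤ K` is itself (balls are hull-sets). [folklore] -/
theorem uFrame_hull_ball [Fact p.Prime] (j : toyIndex.Label) (vQ : toyIndex.VQ) {k : ℕ} (hk : k ≤ K) : (uFrame p j vQ).hull (ball p j vQ k) = ball p j vQ k := by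
  rw [uFrame_hull p j vQ (ball_subset_latt p j vQ k)]
  exact congrArg _ (le_antisymm ((ball_subset_ball_iff (two_le_of_prime p) j vQ k _).1 (subset_ball_depth p j vQ (ball_subset_latt p j vQ k)))
    (le_depth p j vQ subset_rfl hk))

/-! ## 9. The data, the column, the full situation, the setting, the region operator, the q-datum -/
/-- **The Θ-DATUM of P♮ᵤ** in `∏_{j ∈ 𝔽_l^⋇}` at the (one, bad) valuation: the tuples whose `j`-component lies in the Θ-lattice at every label
(a PRODUCT SET standing in for the Kummer image of the splitting monoid, cf. HONEST SCOPE). [claim: Mochizuki2012, status: disputed] -/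
def thetaSet (v : toyIndex.V) : Set (plane.StarPacket v) := {ψ | ∀ j : toyIndex.LabelStar, ψ j ∈ thetaLat p j.1 (toyIndex.over v)}

/-- **The q-DATUM of P♮ᵤ**: the tuples whose `j`-component lies in the q-ball `p·Λ_j` at every label (the uninterpreted binder `qK` of
abc-iut-w5-d230's pins). [claim: Mochizuki2012, status: disputed] -/
def qSet (v : toyIndex.V) : Set (plane.StarPacket v) := {ψ | ∀ j : toyIndex.LabelStar, ψ j ∈ ball p j.1 (toyIndex.over v) 1}

/-- **The data (a)(b)(c) of P♮ᵤ** ([IUTchIII] Thm. 3.11 (i)): integral structure `Λ_j`, admissible regions `uAdm`, log-volume `uVol`, splitting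
monoid the Θ-datum, number field the whole global packet. [claim: Mochizuki2012, status: disputed] -/
def uData : MRData plane where
  shellPk := fun j vQ => latt j vQ
  shellSub := fun j v => latt j (toyIndex.over v)
  Adm := fun j vQ A => uAdm p j vQ A
  logvol := fun j vQ A => uVol p j vQ A
  Ψ := fun v _ => thetaSet p v
  act := fun _ _ _ => 0
  Mmod := fun _ => Set.univ

/-- (c)'s global realified Frobenioids: one object, region `Λ_j`, degree its log-volume. [claim: Mochizuki2012, status: disputed] -/
def uDegrees (j : toyIndex.LabelStar) : GlobalDegrees plane j where
  ObjMOD := Unit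
  Objmod := Unit
  natIso := Equiv.refl Unit
  deg := fun _ => uVol p j.1 () (latt j.1 ())
  region := fun _ vQ => latt j.1 vQ

/-- The SITUATION of P♮ᵤ (bi-coric strictification: the same data on every vertical line). (An `abbrev`.) [claim: Mochizuki2012, status: disputed] -/
abbrev uSituation : Situation toyIndex where
  L := plane
  D := fun _ => uData p
  G := fun _ j => uDegrees p j

/-- The COLUMN of P♮ᵤ: identity Kummer transport at every `(n, m)`, unit-group and ball images `Λ_j`. [claim: Mochizuki2012, status: disputed] -/
def uColumn : Column plane where
  frobAdm := fun _ j vQ A => uAdm p j vQ A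
  frobLogvol := fun _ j vQ A => uVol p j vQ A
  frobΨ := fun _ v _ => thetaSet p v
  frobMmod := fun _ _ => Set.univ
  unitImage := fun _ _ j vQ => latt j vQ
  ballImage := fun _ j vQ => latt j vQ
  ObjLGP := ℤ
  frobObjLGP := fun _ => ℤ
  kumLGP := fun _ => Equiv.refl ℤ
  ObjLgp := ℤ
  frobObjLgp := fun _ => ℤ
  kumLgp := fun _ => Equiv.refl ℤ
  thetaPilot := fun _ => 1

/-- The FULL SITUATION of [IUTchIII] Thm. 3.11 for P♮ᵤ (link data abc-iut-w5-d247's `naiveLink`). (An `abbrev`.) [claim: Mochizuki2012, status: disputed] -/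
abbrev uFull : FullSituation toyIndex where
  toSituation := uSituation p
  col := fun _ => uColumn p
  link := naiveLink

/-- The Θ-GLUE reading the object: the lgp-object of exponent `k` at label `j` is the co-rank-one lattice of ball-depth `k` and top-depth `k·e_j`
(`k = 1`: the Θ-lattice). [claim: Mochizuki2012, status: disputed] -/
def thetaGlue (k : ℤ) (j : toyIndex.Label) (vQ : toyIndex.VQ) : Set (plane.Packet j vQ) := coLatt p j vQ k.toNat (k.toNat * eTop j)

/-- The q-GLUE reading the object: the `△`-object of exponent `k` at label `j` is the ball `p^kΛ_j`. [claim: Mochizuki2012, status: disputed] -/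
def qGlue (k : ℤ) (j : toyIndex.Label) (vQ : toyIndex.VQ) : Set (plane.Packet j vQ) := ball p j vQ k.toNat

/-- At exponent `1` the Θ-glue is the Θ-lattice. [folklore] -/
theorem thetaGlue_one (j : toyIndex.Label) (vQ : toyIndex.VQ) : thetaGlue p 1 j vQ = thetaLat p j vQ := by unfold thetaGlue thetaLat; rw [Int.toNat_one, one_mul]
/-- At exponent `1` the q-glue is the q-ball `p·Λ_j` (at every label). [folklore] -/
theorem qGlue_one (j : toyIndex.Label) (vQ : toyIndex.VQ) : qGlue p 1 j vQ = ball p j vQ 1 := by unfold qGlue; rw [Int.toNat_one]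
/-- `qGlue 1` is a hull-set at every label. [folklore] -/
theorem qGlue_one_mem (j : toyIndex.Label) (vQ : toyIndex.VQ) : qGlue p 1 j vQ ∈ uHul p j vQ := by rw [qGlue_one]; exact ball_mem_uHul p j vQ (by decide)

/-- **The setting P♮ᵤ of Cor. 3.12** over `uSituation p` (column `n = 0`): honest object side (abc-iut-w4-d101's `ExpMonoid` / `pinSig`, pilots of
exponent `1`), the SCALAR frame `uFrame`, glue reading the object. [claim: Mochizuki2012, status: disputed] -/
def uSetting : Setting (uSituation p) where
  n := 0
  HT := ℤ × ℤ
  LogLink := fun _ _ => Unit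
  IsFull := fun _ => True
  lattice :=
    { theater := fun n m => (n, m)
      distinct := fun p q h => by simpa using h
      logLink := fun _ _ => ()
      logLink_full := fun _ _ => trivial }
  Frd := Unit
  IsoF := fun _ _ => Unit
  Ob := fun _ => ℤ
  realify := id
  Strip := Unit
  IsoS := fun _ _ => Unit
  M := fun _ _ => ExpMonoid
  sig := pinSig
  split := { Msplit := fun _ _ => ⊤, exists_gen := fun _ _ => ⟨⟨gen, trivial⟩, top_gen_isGenerator⟩ }
  ObΔ := ℤ
  N := fun _ _ => ExpMonoid
  qData :=
    { q := fun _ _ => gen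
      q_gen := fun _ _ => gen_isGenerator
      objOf := fun x => (expOf (x () (Set.mem_univ ())) : ℤ) }
  frame := fun j vQ => uFrame p j vQ
  hul_adm := fun _ _ _ hH => by obtain ⟨k, -, rfl⟩ := hH; exact Or.inl ⟨k, rfl⟩
  thetaRegionOf := fun _ k j vQ => thetaGlue p k j vQ
  qRegionOf := fun k j vQ => qGlue p k j vQ
  qRegion_mem := fun j vQ => qGlue_one_mem p j vQ
  qSupport_finite := fun _ => Set.toFinite _

/-- **The region operator `ρ` of P♮ᵤ**: at a label `j ∈ 𝔽_l^⋇`, the SET OF `j`-COMPONENTS of the datum at the bad valuation; the q-ball at the zero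
label. Equivariant under every integral family — in particular under ⟨(Ind1)∪(Ind2)⟩ (part III). [claim: Mochizuki2012, status: disputed] -/
def ptRegion (Ψ : ∀ v : toyIndex.V, v ∈ toyIndex.Vbad → Set (plane.StarPacket v)) (j : toyIndex.Label) (vQ : toyIndex.VQ) :
    Set (plane.Packet j vQ) :=
  if h : j = 0 then ball p j vQ 1 else {y | ∃ ψ ∈ Ψ () (Set.mem_univ ()), y = ψ ⟨j, h⟩}

/-- **The q-pilot's Kummer datum in P♮ᵤ**: the q-datum `qSet`. [claim: Mochizuki2012, status: disputed] -/
def qDatumU : ∀ v : toyIndex.V, v ∈ toyIndex.Vbad → Set (plane.StarPacket v) := fun v _ => qSet p v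

end UnionWitness

end Summit.ABC.IUTFork.Cor312Vol

end
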